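import Mathlib
import Summits.NavierStokesRegularity.NavierStokesRegularity.Theorems.FilamentSkeletonRssSelectionBoxRJRungTruePartnerArc
import Summits.NavierStokesRegularity.NavierStokesRegularity.Theorems.FilamentSkeletonRssSelectionBoxRJRungTruePartnerDeriv

/-!
# Route `FilamentSkeletonRss` · crux `SelectionBoxRJ` (stmt-NavierStokesRegularity-21220) — RUNG 2, clause 11 proper:
# the true-partner arc has exactly one stagnation zero, on the supercritical side

Lane `ns-filament-19175-p1` (g7); helper file `--supports stmt-NavierStokesRegularity-21220`, route-independent.

* `slip_strictMonoOn_Iic'`, `slip_zero_package'` — the R1 zero analysis with the `C¹` forcing tolerance widened to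
  `ε₁ ≤ 7/20` (slope window `[8/5, 7/2]`);
* `truePartnerArc_zero` — RUNG 2 of the ladder with CLAUSE 11 PROPER: for `0 < Rb ≤ 1/500`, `Γ ≥ exp(Rb⁻²)`,
  `0 < η ≤ 7/(Γ log Γ)`, the true-partner cut-off local-induction arc of `truePartnerArc_rung` (all its clauses are
  re-exported) has a slip `w` that is differentiable and strictly increasing on `(−∞, 0]`, positive on `[0, ∞)`, with
  EXACTLY ONE zero `c₀` on `ℝ`, located in `(−(9/20)√Γ, −(7/20)√Γ)`, and `8/5 ≤ w′(c₀) ≤ 7/2` (strictly above the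
  `3/2` threshold: `δ = 1/10`, `Λ = 7/2`); the `C¹` input is `partnerField_deriv_sub_le` (`ε₁ = 710/3000`).

HONEST FRAMING.  The self-induction is still modelled by local induction (cut-off binormal flow); R3 owes the LIA remainder.
MODEL-side bookkeeping for a HYPOTHETICAL filament box; NOT an instance of `SelectionBoxRJ`; nothing here is a claim about
Navier–Stokes regularity or blow-up.
-/

set_option linter.dupNamespace false -- `Theorems.…Theorems`-style path/namespace repetition is the tree convention

noncomputable section

namespace Summit.NavierStokesRegularity.NavierStokesRegularity.Theorems

open Set Function Filter MeasureTheory Real Metric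
open Literature.Analysis.FluidPDE
open scoped InnerProductSpace Topology

namespace SelectionBoxRJRung

/-- **Strict monotonicity on `(−∞, 0]`, wide version (`ε₁ ≤ 7/20`):** there `w′ ≥ ½ − 12θ − ε₁ > 0` (rung 0's frozen
partner strain `⟪U′, e⟫ ≥ 0` for `t ≤ 0`). [folklore] -/
theorem slip_strictMonoOn_Iic' {Γ θ ε₁ : ℝ} (hΓ : 10 ^ 4 ≤ Γ) (hθ1 : θ ≤ 1 / 500) (hε₁ : ε₁ ≤ 7 / 20)
    (U : ℝ → EuclideanSpace ℝ (Fin 3))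
    (hU : ∀ t, U t = (2 * Γ / Real.pi / (4 * Γ / 25 + 1 + t ^ 2)) •
      ((2 * Real.sqrt Γ / 5) • (WithLp.toLp 2 ![0, (Real.sqrt 2)⁻¹, (Real.sqrt 2)⁻¹] : EuclideanSpace ℝ (Fin 3)) -
        t • WithLp.toLp 2 ![(1:ℝ), 0, 0]))
    {x f : ℝ → EuclideanSpace ℝ (Fin 3)} {c : ℝ → ℝ} (hx : ContDiff ℝ 2 x) (hunit : ∀ t, ‖deriv x t‖ = 1)
    (hθ : ∀ s, ‖deriv x s - WithLp.toLp 2 ![0, (Real.sqrt 2)⁻¹, (Real.sqrt 2)⁻¹]‖ ≤ θ)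
    (hode : ∀ t, iteratedDeriv 2 x t = c t • cross (deriv x t)
      ((1 / 2 : ℝ) • x t - (21 / 5 : ℝ) • cross (EuclideanSpace.single 2 1) (x t) + f t))
    (hf : Differentiable ℝ f) (hf1 : ∀ t, ‖deriv f t - deriv U t‖ ≤ ε₁)
    (w : ℝ → ℝ) (hw : ∀ t, w t = ⟪deriv x t,
        ((1 / 2 : ℝ) • x t - (21 / 5 : ℝ) • cross (EuclideanSpace.single 2 1) (x t)) + f t⟫_ℝ) :
    StrictMonoOn w (Iic 0) := by
  have hΓ0 : 0 < Γ := by linarith [show (0:ℝ) < 10 ^ 4 by norm_num]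
  have hwf : w = fun s => ⟪deriv x s,
      ((1 / 2 : ℝ) • x s - (21 / 5 : ℝ) • cross (EuclideanSpace.single 2 1) (x s)) + f s⟫_ℝ := funext hw
  refine strictMonoOn_of_hasDerivAt_pos (convex_Iic 0) (f' := deriv w)
    (fun t _ => by rw [hwf]; exact (cutoff_slip_hasDerivAt hx hunit hode hf t).differentiableAt.hasDerivAt)
    (fun t ht => ?_)
  have h := slip_deriv_sub_le hΓ0 U hU hx hunit hθ hode hf hf1 w hw t
  have hpos := inner_U_deriv_eT_nonneg hΓ0.le U hU (mem_Iic.1 ht)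
  have h2 := (abs_le.1 h).1
  linarith

/-- **The stagnation-zero package, wide version (`ε₁ ≤ 7/20`).**  As `…RungModelArcZero.slip_zero_package` but with the
`C¹` forcing tolerance widened to `ε₁ ≤ 7/20` (what the true partner of RUNG 2 supplies, `ε₁ = 710/3000`): the slip `w` is
differentiable, strictly increasing on `(−∞, 0]`, has EXACTLY ONE zero `c₀` on `ℝ`, and every zero satisfies
`−(9/20)√Γ < c₀ < −(7/20)√Γ`, waist `‖x c₀‖ ≤ √Γ/2`, tilt `|⟪x′ c₀, e₃⟫| ≤ 1 − 1/5`, and the SUPERCRITICAL slope window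
`8/5 ≤ w′ c₀ ≤ 7/2` (rung 0: `[2, 31/10]`, widened by `12θ + ε₁ ≤ 187/500`). [folklore] -/
theorem slip_zero_package' {Γ θ ε₀ ε₁ : ℝ} (hΓ : 10 ^ 4 ≤ Γ) (hθ0 : 0 ≤ θ) (hθ1 : θ ≤ 1 / 500) (hε₀ : ε₀ ≤ 1 / 100)
    (hε₁ : ε₁ ≤ 7 / 20) (U : ℝ → EuclideanSpace ℝ (Fin 3))
    (hU : ∀ t, U t = (2 * Γ / Real.pi / (4 * Γ / 25 + 1 + t ^ 2)) •
      ((2 * Real.sqrt Γ / 5) • (WithLp.toLp 2 ![0, (Real.sqrt 2)⁻¹, (Real.sqrt 2)⁻¹] : EuclideanSpace ℝ (Fin 3)) -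
        t • WithLp.toLp 2 ![(1:ℝ), 0, 0]))
    {x f : ℝ → EuclideanSpace ℝ (Fin 3)} {c : ℝ → ℝ} (hx : ContDiff ℝ 2 x) (hunit : ∀ t, ‖deriv x t‖ = 1)
    (hx0 : x 0 = WithLp.toLp 2 ![Real.sqrt Γ / 5, 0, 0])
    (hθ : ∀ s, ‖deriv x s - WithLp.toLp 2 ![0, (Real.sqrt 2)⁻¹, (Real.sqrt 2)⁻¹]‖ ≤ θ)
    (hode : ∀ t, iteratedDeriv 2 x t = c t • cross (deriv x t)
      ((1 / 2 : ℝ) • x t - (21 / 5 : ℝ) • cross (EuclideanSpace.single 2 1) (x t) + f t))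
    (hf : Differentiable ℝ f) (hf0 : ∀ t, ‖f t - U t‖ ≤ ε₀ * Real.sqrt Γ) (hf1 : ∀ t, ‖deriv f t - deriv U t‖ ≤ ε₁)
    (w : ℝ → ℝ) (hw : ∀ t, w t = ⟪deriv x t,
        ((1 / 2 : ℝ) • x t - (21 / 5 : ℝ) • cross (EuclideanSpace.single 2 1) (x t)) + f t⟫_ℝ) :
    Differentiable ℝ w ∧
    (∃ c₀ : ℝ, w c₀ = 0 ∧ ∀ τ, w τ = 0 → τ = c₀) ∧
    (∀ c₀ : ℝ, w c₀ = 0 →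
      -(9 / 20) * Real.sqrt Γ < c₀ ∧ c₀ < -(7 / 20) * Real.sqrt Γ ∧ ‖x c₀‖ ≤ Real.sqrt Γ / 2 ∧
      |⟪deriv x c₀, EuclideanSpace.single 2 1⟫_ℝ| ≤ 1 - 1 / 5 ∧
      StrictMonoOn w (Iic 0) ∧ 8 / 5 ≤ deriv w c₀ ∧ deriv w c₀ ≤ 7 / 2) := by
  have hΓ0 : 0 < Γ := by linarith [show (0:ℝ) < 10 ^ 4 by norm_num]
  have hG : 0 < Real.sqrt Γ := Real.sqrt_pos.2 hΓ0
  have hxd : Differentiable ℝ x := hx.differentiable (by norm_num)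
  have hwf : w = fun s => ⟪deriv x s,
      ((1 / 2 : ℝ) • x s - (21 / 5 : ℝ) • cross (EuclideanSpace.single 2 1) (x s)) + f s⟫_ℝ := funext hw
  have hwd : ∀ t, HasDerivAt w (1 / 2 + ⟪deriv f t, deriv x t⟫_ℝ) t := fun t => by
    rw [hwf]; exact cutoff_slip_hasDerivAt hx hunit hode hf t
  have hdiff : Differentiable ℝ w := fun t => (hwd t).differentiableAt
  have hcont : Continuous w := hdiff.continuous
  have hneg := slip_neg_at hΓ hθ0 hθ1 hε₀ U hU hxd hunit hx0 hθ hf0 w hw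
  have hpos := slip_pos_at hΓ hθ0 hθ1 hε₀ U hU hxd hunit hx0 hθ hf0 w hw
  have hmono := slip_strictMonoOn_Iic' hΓ hθ1 hε₁ U hU hx hunit hθ hode hf hf1 w hw
  have hposR : ∀ t, 0 ≤ t → 0 < w t := fun t ht =>
    slip_pos_of_nonneg hΓ hθ0 hθ1 hε₀ U hU hxd hunit hx0 hθ hf0 w hw ht
  -- location of every zero
  have hloc : ∀ c₀, w c₀ = 0 → -(9 / 20) * Real.sqrt Γ < c₀ ∧ c₀ < -(7 / 20) * Real.sqrt Γ := by
    intro c₀ hc₀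
    have hc₀neg : c₀ < 0 := by
      by_contra h; exact absurd hc₀ (hposR c₀ (not_lt.1 h)).ne'
    have ha : -(9 / 20) * Real.sqrt Γ ∈ Iic (0:ℝ) := by simp [mem_Iic]
    have hb : -(7 / 20) * Real.sqrt Γ ∈ Iic (0:ℝ) := by simp [mem_Iic]
    have hc : c₀ ∈ Iic (0:ℝ) := hc₀neg.le
    constructor
    · by_contra h
      rw [not_lt] at h
      have := hmono.monotoneOn hc ha h
      linarith
    · by_contra h
      rw [not_lt] at h
      have := hmono.monotoneOn hb hc h
      linarith
  refine ⟨hdiff, ?_, ?_⟩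
  · -- existence and uniqueness
    have hab : -(9 / 20) * Real.sqrt Γ ≤ -(7 / 20) * Real.sqrt Γ := by nlinarith
    obtain ⟨c₀, _, hc₀⟩ := intermediate_value_Ioo hab hcont.continuousOn ⟨hneg, hpos⟩
    refine ⟨c₀, hc₀, fun τ hτ => ?_⟩
    have hτ0 : τ < 0 := by
      by_contra h; exact absurd hτ (hposR τ (not_lt.1 h)).ne'
    have hc0 : c₀ < 0 := by
      have := (hloc c₀ hc₀).2; nlinarith
    exact hmono.injOn (show τ ∈ Iic (0:ℝ) from hτ0.le) (show c₀ ∈ Iic (0:ℝ) from hc0.le) (hτ.trans hc₀.symm)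
  · intro c₀ hc₀
    obtain ⟨hc1, hc2⟩ := hloc c₀ hc₀
    have hcabs : |c₀| ≤ 9 / 20 * Real.sqrt Γ := by rw [abs_of_neg (by nlinarith)]; linarith
    refine ⟨hc1, hc2, ?_, ?_, hmono, ?_⟩
    · -- waist
      have hd := arc_displacement_le hxd hx0 hθ c₀
      have hℓ2 := norm_sq_line Γ c₀ hΓ0.le
      set L := ‖(WithLp.toLp 2 ![Real.sqrt Γ / 5, 0, 0] : EuclideanSpace ℝ (Fin 3)) +
        c₀ • WithLp.toLp 2 ![0, (Real.sqrt 2)⁻¹, (Real.sqrt 2)⁻¹]‖ with hL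
      have hLn : 0 ≤ L := norm_nonneg _
      have hG2 : Real.sqrt Γ ^ 2 = Γ := Real.sq_sqrt hΓ0.le
      have hL2 : L ^ 2 ≤ (493 / 1000 * Real.sqrt Γ) ^ 2 := by
        rw [hℓ2]; nlinarith [hG2]
      have hLle : L ≤ 493 / 1000 * Real.sqrt Γ := by
        nlinarith [hL2, hLn, hG]
      have htri : ‖x c₀‖ ≤ L + θ * |c₀| := by
        have := norm_add_le ((WithLp.toLp 2 ![Real.sqrt Γ / 5, 0, 0] : EuclideanSpace ℝ (Fin 3)) +
          c₀ • WithLp.toLp 2 ![0, (Real.sqrt 2)⁻¹, (Real.sqrt 2)⁻¹])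
          (x c₀ - ((WithLp.toLp 2 ![Real.sqrt Γ / 5, 0, 0] : EuclideanSpace ℝ (Fin 3)) +
            c₀ • WithLp.toLp 2 ![0, (Real.sqrt 2)⁻¹, (Real.sqrt 2)⁻¹]))
        rw [add_sub_cancel] at this
        linarith
      nlinarith [mul_le_mul hθ1 hcabs (abs_nonneg _) (by norm_num), hG]
    · -- tilt at the zero
      have he3 : ‖(EuclideanSpace.single (2 : Fin 3) (1 : ℝ) : EuclideanSpace ℝ (Fin 3))‖ = 1 := by simp
      have hsplit : ⟪deriv x c₀, EuclideanSpace.single 2 1⟫_ℝ =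
          ⟪(WithLp.toLp 2 ![0, (Real.sqrt 2)⁻¹, (Real.sqrt 2)⁻¹] : EuclideanSpace ℝ (Fin 3)),
            EuclideanSpace.single 2 1⟫_ℝ +
          ⟪deriv x c₀ - WithLp.toLp 2 ![0, (Real.sqrt 2)⁻¹, (Real.sqrt 2)⁻¹], EuclideanSpace.single 2 1⟫_ℝ := by
        rw [← inner_add_left, add_sub_cancel]
      have he : ⟪(WithLp.toLp 2 ![0, (Real.sqrt 2)⁻¹, (Real.sqrt 2)⁻¹] : EuclideanSpace ℝ (Fin 3)),
          EuclideanSpace.single 2 1⟫_ℝ = (Real.sqrt 2)⁻¹ := by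
        rw [single_two_eq_vec3, inner_vec3]; ring
      have hrest : |⟪deriv x c₀ - WithLp.toLp 2 ![0, (Real.sqrt 2)⁻¹, (Real.sqrt 2)⁻¹],
          (EuclideanSpace.single 2 1 : EuclideanSpace ℝ (Fin 3))⟫_ℝ| ≤ θ := by
        calc _ ≤ ‖deriv x c₀ - WithLp.toLp 2 ![0, (Real.sqrt 2)⁻¹, (Real.sqrt 2)⁻¹]‖ *
              ‖(EuclideanSpace.single (2 : Fin 3) (1 : ℝ) : EuclideanSpace ℝ (Fin 3))‖ := abs_real_inner_le_norm _ _
          _ ≤ θ := by rw [he3, mul_one]; exact hθ c₀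
      obtain ⟨hs1, hs2⟩ := sqrt_two_bounds
      have hinv : (Real.sqrt 2)⁻¹ ≤ 0.70711 := by
        rw [inv_le_comm₀ (by positivity) (by norm_num)]; nlinarith
      have hinv0 : 0 ≤ (Real.sqrt 2)⁻¹ := by positivity
      rw [hsplit, he]
      have := abs_add_le ((Real.sqrt 2)⁻¹) (⟪deriv x c₀ - WithLp.toLp 2 ![0, (Real.sqrt 2)⁻¹, (Real.sqrt 2)⁻¹],
          (EuclideanSpace.single 2 1 : EuclideanSpace ℝ (Fin 3))⟫_ℝ)
      rw [abs_of_nonneg hinv0] at this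
      linarith
    · -- slope window
      obtain ⟨hb1, hb2⟩ := b_bounds hΓ
      have h := slip_deriv_sub_le hΓ0 U hU hx hunit hθ hode hf hf1 w hw c₀
      rw [inner_U_deriv_eT_eq_profile hΓ0 U hU c₀] at h
      have hs1 : -9 / 20 ≤ c₀ / Real.sqrt Γ := by rw [le_div_iff₀ hG]; linarith
      have hs2 : c₀ / Real.sqrt Γ ≤ -7 / 20 := by rw [div_le_iff₀ hG]; linarith
      obtain ⟨hw1, hw2⟩ := Fderiv_window_wide (b := 4 / 25 + 1 / Γ) hb1 hb2 hs1 hs2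
      obtain ⟨hl, hu⟩ := abs_le.1 h
      constructor
      · linarith
      · linarith

/-- **RUNG 2 with clause 11 proper.**  See the module docstring. [folklore] -/
theorem truePartnerArc_zero {Γ Rb η : ℝ} (hRb0 : 0 < Rb) (hRb : Rb ≤ 1 / 500) (hΓ : Real.exp (1 / Rb ^ 2) ≤ Γ)
    (hη0 : 0 < η) (hη : η * (Γ * Real.log Γ) ≤ 7) :
    ∃ (χ : ℝ → ℝ) (x : ℝ → EuclideanSpace ℝ (Fin 3)) (f : ℝ → EuclideanSpace ℝ (Fin 3)) (w : ℝ → ℝ) (c₀ : ℝ),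
      ((∀ n : ℕ∞, ContDiff ℝ n χ) ∧ (∀ t, |t| ≤ 11 / 10 * (Rb * Real.sqrt (Γ * Real.log Γ)) → χ t = 1) ∧
        (∀ t, 6 / 5 * (Rb * Real.sqrt (Γ * Real.log Γ)) ≤ |t| → χ t = 0) ∧ (∀ t, 0 ≤ χ t ∧ χ t ≤ 1)) ∧
      -- the TRUE partner forcing along `x` and the nonlocal cut-off local-induction equation
      ((∀ t, f t = (Γ * 4 / (4 * Real.pi)) • ∫ σ : ℝ,
          ((‖x t - ((2 * ⟪x σ, EuclideanSpace.single 2 1⟫_ℝ) • (EuclideanSpace.single (2 : Fin 3) (1 : ℝ)) - x σ)‖ ^ 2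
              + 1) ^ (3 / 2 : ℝ))⁻¹ •
            cross (deriv (fun u => (2 * ⟪x u, EuclideanSpace.single 2 1⟫_ℝ) •
                (EuclideanSpace.single (2 : Fin 3) (1 : ℝ)) - x u) σ)
              (x t - ((2 * ⟪x σ, EuclideanSpace.single 2 1⟫_ℝ) • (EuclideanSpace.single (2 : Fin 3) (1 : ℝ)) - x σ))) ∧
        ContDiff ℝ 2 x ∧ x 0 = WithLp.toLp 2 ![Real.sqrt Γ / 5, 0, 0] ∧
        deriv x 0 = WithLp.toLp 2 ![0, (Real.sqrt 2)⁻¹, (Real.sqrt 2)⁻¹] ∧ (∀ t, ‖deriv x t‖ = 1) ∧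
        (∀ t, iteratedDeriv 2 x t = (η * χ t) • cross (deriv x t)
          ((1 / 2 : ℝ) • x t - (21 / 5 : ℝ) • cross (EuclideanSpace.single 2 1) (x t) + f t))) ∧
      -- near-straightness, curvature (clause 2), straight arms
      ((∀ t, ‖deriv x t - WithLp.toLp 2 ![0, (Real.sqrt 2)⁻¹, (Real.sqrt 2)⁻¹]‖ ≤ 1 / 3000) ∧
        (∀ t, ‖iteratedDeriv 2 x t‖ * Real.sqrt Γ ≤ 1) ∧
        (∀ t, 6 / 5 * (Rb * Real.sqrt (Γ * Real.log Γ)) ≤ |t| → iteratedDeriv 2 x t = 0)) ∧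
      -- radial growth, properness, chord–arc, separation from the partner `R_π ∘ x` (clause 3)
      ((∀ t, 2999 / 3000 * |t| ≤ ‖x t‖) ∧ Tendsto (fun t => ‖x t‖) (cocompact ℝ) atTop ∧
        (∀ τ σ, 1 / 2 * |τ - σ| ≤ ‖x τ - x σ‖) ∧
        (∀ τ σ, 39 / 100 * Real.sqrt Γ ≤
          ‖x τ - ((2 * ⟪x σ, EuclideanSpace.single 2 1⟫_ℝ) • (EuclideanSpace.single (2 : Fin 3) (1 : ℝ)) - x σ)‖)) ∧
      -- the slip against the TRUE partner field and MODEL TANGENCY on the ball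
      ((∀ t, w t = ⟪deriv x t,
          ((1 / 2 : ℝ) • x t - (21 / 5 : ℝ) • cross (EuclideanSpace.single 2 1) (x t)) + f t⟫_ℝ) ∧ Continuous w ∧
        (∀ t, ‖x t‖ ≤ Rb * Real.sqrt (Γ * Real.log Γ) →
          ((1 / 2 : ℝ) • x t - (21 / 5 : ℝ) • cross (EuclideanSpace.single 2 1) (x t)) + f t +
              η⁻¹ • cross (deriv x t) (iteratedDeriv 2 x t) = w t • deriv x t)) ∧
      -- the stagnation zero at `C⁰` level: signs, existence and location, waist (9), tilt (10), no zero on `[0, ∞)`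
      (w (-(9 / 20) * Real.sqrt Γ) < 0 ∧ 0 < w (-(7 / 20) * Real.sqrt Γ) ∧ w c₀ = 0 ∧
        -(9 / 20) * Real.sqrt Γ < c₀ ∧ c₀ < -(7 / 20) * Real.sqrt Γ ∧ ‖x c₀‖ ≤ 1 / 2 * Real.sqrt Γ ∧
        |⟪deriv x c₀, EuclideanSpace.single 2 1⟫_ℝ| ≤ 1 - 1 / 5 ∧ (∀ t, 0 ≤ t → 0 < w t)) ∧
      -- CLAUSE 11 PROPER: `f` and `w` differentiable, `w` strictly increasing on `(−∞, 0]`, the zero is UNIQUE on `ℝ`,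
      -- and the slope at it lies in the supercritical window `[8/5, 7/2]`
      (Differentiable ℝ f ∧ Differentiable ℝ w ∧ StrictMonoOn w (Iic 0) ∧ (∀ τ, w τ = 0 → τ = c₀) ∧
        8 / 5 ≤ deriv w c₀ ∧ deriv w c₀ ≤ 7 / 2) := by
  obtain ⟨hΓ4, -, -, -, -, -⟩ := picard_constants hRb0 hRb hΓ hη0 hη
  have hΓ0 : 0 < Γ := by linarith [show (0:ℝ) < 10 ^ 4 by norm_num]
  obtain ⟨χ, x, f, w, c₀, hχ, ⟨hf, hxc, hx0, hx0', hxu, hxode⟩, ⟨hnear, hcurv, harm⟩, h3, ⟨hw, hwc, htan⟩,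
    ⟨hneg, hpos, hc₀, hc1, hc2, hwaist, htilt, hposR⟩⟩ := truePartnerArc_rung hRb0 hRb hΓ hη0 hη
  have hx1 : ContDiff ℝ 1 x := hxc.of_le (by norm_num)
  -- the frozen forcing, `C⁰` and `C¹` closeness
  set U : ℝ → EuclideanSpace ℝ (Fin 3) := fun t => (2 * Γ / Real.pi / (4 * Γ / 25 + 1 + t ^ 2)) •
      ((2 * Real.sqrt Γ / 5) • (WithLp.toLp 2 ![0, (Real.sqrt 2)⁻¹, (Real.sqrt 2)⁻¹] : EuclideanSpace ℝ (Fin 3)) -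
        t • WithLp.toLp 2 ![(1:ℝ), 0, 0]) with hUdef
  have hU : ∀ t, U t = (2 * Γ / Real.pi / (4 * Γ / 25 + 1 + t ^ 2)) •
      ((2 * Real.sqrt Γ / 5) • (WithLp.toLp 2 ![0, (Real.sqrt 2)⁻¹, (Real.sqrt 2)⁻¹] : EuclideanSpace ℝ (Fin 3)) -
        t • WithLp.toLp 2 ![(1:ℝ), 0, 0]) := fun t => rfl
  have hf0 : ∀ t, ‖f t - U t‖ ≤ 28 * (1 / 3000) * Real.sqrt Γ := fun t => by
    rw [hf t]; exact partnerField_sub_U_le (θ := 1 / 3000) hΓ0 (by norm_num) (by norm_num) U hU hx1 hxu hx0 hnear t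
  obtain ⟨hfd, hf1⟩ := partnerField_deriv_sub_le (θ := 1 / 3000) hΓ0 (by norm_num) (by norm_num) U hU hx1 hxu hx0
    hnear f hf
  have hf1' : ∀ t, ‖deriv f t - deriv U t‖ ≤ 710 * (1 / 3000) := hf1
  -- the wide zero package
  obtain ⟨hwd, ⟨c₁, hc₁, huniq⟩, hall⟩ := slip_zero_package' (θ := 1 / 3000) (ε₀ := 28 * (1 / 3000))
    (ε₁ := 710 * (1 / 3000)) (c := fun t => η * χ t) hΓ4 (by norm_num) (by norm_num) (by norm_num) (by norm_num)
    U hU hxc hxu hx0 hnear hxode hfd hf0 hf1' w hw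
  have hc₀₁ : c₀ = c₁ := huniq c₀ hc₀
  obtain ⟨-, -, -, -, hmono, hsl1, hsl2⟩ := hall c₀ hc₀
  exact ⟨χ, x, f, w, c₀, hχ, ⟨hf, hxc, hx0, hx0', hxu, hxode⟩, ⟨hnear, hcurv, harm⟩, h3, ⟨hw, hwc, htan⟩,
    ⟨hneg, hpos, hc₀, hc1, hc2, hwaist, htilt, hposR⟩,
    ⟨hfd, hwd, hmono, fun τ hτ => (huniq τ hτ).trans hc₀₁.symm, hsl1, hsl2⟩⟩

end SelectionBoxRJRung

end Summit.NavierStokesRegularity.NavierStokesRegularity.Theorems
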